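import Summits.QuantumFields.BalabanUV.Beta.SymAveragingHessianCounts
import Summits.QuantumFields.BalabanUV.Beta.SymmetrisedAxialReflection
import Summits.QuantumFields.BalabanUV.Beta.SymAveragingWardRooted
import Literature.MathematicalPhysics.QuantumFieldTheory.Balaban1983to89.Beta.RootedKernelReflection

/-!
COURIER NOTE (b2b-balaban-beta-d1-formalise-leaf-05 gen 21, 2026-08-21): an1-g43's scratch file `s2e/SymRootedKernelReflection.lean` v1.1
(sha16 9d52695fba7df127, 503 l.; journal [AN1-G43-S2E-V11] l.34351) exceeds the tree's 400-line lint (`lint.size`, gate dry-run «this one has 504»),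
so it is filed as TWO modules with EVERY declaration byte-identical, in the original order and in the original namespace
`Summit.QuantumFields.BalabanUV.Beta.SymRootedKernelReflection` (all fully-qualified names unchanged): THIS module
`Beta.SymRootedKernelReflectionCore` = §§1–5 (letter lists, pair words, counts, the count sign laws; 0 def) and
`Beta.SymRootedKernelReflection` = §§6–8 (real kernels, transport, the def `symCtE`, packed laws, `hHr_sym`; imports this one).
The module docstring below is an1's v1.1, verbatim, and describes BOTH parts.

# `BalabanUV.Beta.SymRootedKernelReflection` — binder row D1, TABLES-SYM-LEAN step S2e #1 (hR, FIRST ORDER): **THE REFLECTION LAWS OF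
# an1's SYMMETRISED FIRST-ORDER AVERAGING KERNELS AND PACKED TABLES at the centred root** (`L` odd, EVERY axis) — the port of an5's
# `Beta.RootedKernelReflection` §§3–7 from the comb words `γ^ρ` of node 7aρ to the `(σ,σ′)`-PAIR WORDS `γ^{σ,σ′}` of gen 41's (0.4) averaging
# (`Beta.SymAveragingHessianCountsWords.gammaPAt`), letter level and packed; the binder `hHr` of the roots of record becomes a theorem

HONEST FRAMING (cell charter, verbatim): «discharging `BetaPertH` makes Bałaban's UV stability UNCONDITIONAL — a real constructive-QFT
result; it is NOT the continuum limit and NOT the Clay problem.»  DERIVED cell leaf (pub-balaban β sub-cell, row BETA, lane an1, gen 43):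
[folklore] transport of structure (finite letter-list algebra + sign bookkeeping) for gen 41's symmetrised kernels `symLinKerAt`,
`symHessKerAt`, `symVhKerAt` (`Beta.SymAveragingHessianCounts` §7) and their packings `symVhSAt`, `symVhSaddAt`, `symHessFFAt` (§8 there) at
the CENTRED root `ρ_c = ctr d L`, `L` odd, under the block-compatible reflection of one lattice axis (`Beta.ResolventReflection.sref/bref/R1`,
gen 42's `Beta.SymmetrisedAxialReflection`).  No statement of Bałaban's papers is typed here, no `[cite:]` tag, no `Prop` fact, no
`BetaPertH`; NOT continuum; NOT Clay.  Nothing printed is asserted; one [our object] `symCtE` (the contact family, asserting nothing).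

WHAT IS PROVED (`α` the reflected axis, `ε_κ = reflSign α κ`, integer copy `zsgn`; bond map `fref α (κ, x) = (κ, bref α κ x)`; block map
`y ↦ y′ = bref α μ y`; root `ρ_c = ctr d L`, `Odd L`; `q_sym = symLinCountAt` (weight `d!`), `h_sym = symHessCountAt`, `m_sym = symVhCountAt`):

* §1 transport of the pair words: `axialP_R1`; **`gammaPAt_R1_of_ne`** (`μ ≠ α`: `γ^{σ,σ′}_{ρ_c}(R₁A)_{(μ,y),b} = γ^{σ,σ′}_{ρ_c}(A)_{(μ,y′),b̄}`) and
  **`gammaPAt_R1_self`** — ALONG THE AXIS THE TWO ORDERS SWAP AND THE WORD REVERSES: `γ^{σ,σ′}(R₁A)_{(α,y),b} = rev γ^{σ′,σ}(A)_{(α,y′),b̄}`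
  (so no per-`(σ,σ′)` sign law exists on the axis; the DOUBLE SUM `Σ_σ Σ_{σ′}` absorbs the swap) — and of the pair-form words
  (`gammaPAt_pairForm_R1_of_ne/_self`, via S2b's landed projections `SymAveragingWardRooted.bg_/fl_gammaPAt_pairForm` BY NAME), whence the wedge
  law for the double sum   **`sum_wedge_gammaPAt_pairForm_R1`** `Σ_{σσ′} wedge γ^{σσ′}(R₁A, R₁B)_{(μ,y),b} = ε_μ Σ_{σσ′} wedge γ^{σσ′}(A, B)_{(μ,y′),b̄}`;
* §2 `sum_sum_gammaPAt_sum` (`Σ_b Σ_{σσ′} Σγ = d! • symLinU`; the one-line corollary of S2b's landed `SymAveragingWardRooted.sum_pair_gammaPAt_sum`) and **`symHessCountAt_eq_sum_wedge`** — for EVERY root: `h_sym ρ L μ y f f′ =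
  Σ_{b} Σ_{σσ′} wedge γ^{σσ′}_{ρ}(δ_f, δ_{f′})` (the closing-bond terms of gen 41's three-term formula cancel against the closing segment);
* §3–§4 casts: `cast_symLinCountAt` (`= symLinAvgAt ρ (single f 1)`), `cast_symHessCountAt`;
* §5 THE PURE SIGN LAWS **`symLinCountAt_fref`** `q_sym(f̄)_{(μ,y)} = ε_{f.1} ε_μ q_sym(f)_{(μ,y′)}` (gen 42's `symLinAvgAt_R1` on `single f 1`),
  **`symHessCountAt_fref`** `h_sym(f̄,f̄′)_{(μ,y)} = ε_{f.1} ε_{f′.1} ε_μ h_sym(f,f′)_{(μ,y′)}`, and the product chart UP TO TWO CONTACTS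
  **`symVhCountAt_fref`** `ε_{f.1}ε_{f′.1} m_sym(f̄,f̄′) = ε_μ m_sym(f,f′) − 2ε_μ L^d d! [f = f′ ∥ α] q_sym(f) − (1 − ε_μ) q_sym(f) q_sym(f′)` (at `(μ,y′)`);
* §6 the same laws for the real kernels: **`symLinKerAt_fref`**, **`symHessKerAt_fref`**, **`symVhKerAt_fref`** (shape of an5's `vhKerAt_fref`
  verbatim with `q¹ ↦ q¹_sym`: contacts `−ε_μ [f = f′ ∥ α] q¹_sym(f)` and `−[μ = α] q¹_sym(f) q¹_sym(f′)`);
* §7 the transport: **`TKer_symHessKerAt`** (`h_sym` invariant), the contact family **`symCtE α L`** `= [f = f′ ∥ α] q¹_sym(f) − [μ = α] q¹_sym(f) q¹_sym(f′)`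
  ([our object]) with **`TKer_symCtE`** (`𝒯_α E^sym_α = −E^sym_α`) and **`TKer_symVhKerAt`** (`𝒯_α m_sym = m_sym − E^sym_α`);
* §8 THE PACKED LAWS in the (Sr)/(Wr) currency of `Beta.ResolventReflection` (dimension `n + 1`, root `ctr (n+1) L`), by an5's generic
  `packVH_bref` / `packVH_(anti)reflect_of_TKer` BY NAME: **`symVhSaddAt_reflect`** (the ADDITIVE-CHART family obeys `hSr` VERBATIM, every axis),
  **`symVhSAt_bref`** `symVhSAt ρ_c κ′ (bref α κ′ u) = ε_{κ′} • refK (Φ L α) (symVhSAt ρ_c κ′ u − packVH E^sym_α L κ′ u)` (the (V-r) letter in kernel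
  currency), **`symCtS_antireflect`**, **`symVhSAt_half_reflect`**, **`symHessFFAt_reflect`** `symHessFFAt ρ_c L μ (bref α μ y) = ε_μ • refK (Φ N α)
  (symHessFFAt ρ_c L μ y)` (any blocking `N`), and at the root of record (`n + 1 = 4`, `N = L = Lc`) **`hHr_sym`** — the binder `hHr` of
  `RowD1JointEndSymReflTablesAn1S2(M).d1Drift_JsB12Sym_an1TablesS2_of_…` (ROOT F :133 = ROOT G :133), VERBATIM.

USE: S2e #2 `Beta.SymVhSliceReflectionAn1` turns `symVhSAt_bref` into the three border letters `hVfm`/`hVmf`/`hVmm` of the same roots against the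
symmetrised bordered Hessian `bhK Lc + Dsh Lc` (e3's border-reading generator `ctGenM`); with `hHr_sym` the four hR FIRST-ORDER table letters of
the roots of record are theorems.  The SECOND-ORDER letters `hV2`/`hH2` and the `hW*` letters are S2d's (`Beta.SymSecondOrderTablesAn1` ff.).

Provenance: b2b-balaban β sub-cell, row BETA, lane an1 (W-supplier «AN1»), gen 43, 2026-08-21 (TABLES-SYM-LEAN S2e; GAPS § C-an1-134); over an5's
`Beta.RootedKernelReflection` v1.1 (list algebra, `fref`/`zsgn`, `TKer`, `packVH_bref`, `packVH_(anti)reflect_of_TKer`, `cCountAt_fref` BY NAME), gen 41's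
`Beta.SymAveragingHessianCounts(Words)`, S2b's `Beta.SymAveragingWardRooted` (`bg_/fl_gammaPAt_pairForm`, `sum_pair_gammaPAt_sum`, `symZ_eq_symLinU`) and
gen 42's `Beta.SymmetrisedAxialReflection` (`symLinAvgAt_R1`, `P1_R1`, `psite_symm_sref`) BY NAME — nothing of theirs re-typed.  Bib keys (locators only): Balaban1985Averaging, Balaban1987RG1.

VERSION v1 (2026-08-21, b2b-balaban-beta-an1-g43): new leaf (1 def `symCtE` + theorems; `--kind definition`).
VERSION v1.1 (2026-08-21, b2b-balaban-beta-an1-g43, before filing): the two local copies of the family-independent projections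
`bg_/fl_gammaPAt_pairForm` DELETED in favour of the landed `SymAveragingWardRooted` originals (imported, opened BY NAME — the `dedup.landed` rule);
`sum_sum_gammaPAt_sum` re-proved from the landed `sum_pair_gammaPAt_sum`; no statement of any other declaration changed.
COURIER CUT (2026-08-21, b2b-balaban-beta-d1-formalise-leaf-05-g21): part 1 of 2 = §§1–5 of an1-g43's v1.1 (0 def; `--kind proof`).
-/

noncomputable section

namespace Summit.QuantumFields.BalabanUV.Beta.SymRootedKernelReflection

open Finset
open scoped BigOperators Nat
open Literature.MathematicalPhysics.QuantumFieldTheory.Balaban1983to89.Beta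
open AffineAveraging (Form1 Site unitVec box toSite)
open AveragingContours (segUp segDown rev axial rev_sum segUp_length)
open AveragingContoursRooted (ctr)
open TransportedContourVariables (mapForm mapForm_apply pairForm pairForm_apply bg fl bg_append fl_append segUp_map rev_map
  mapForm_fst_pairForm mapForm_snd_pairForm)
open AveragingHessianKernels (wedge wedge_nil wedge_cons Bond single single_apply δ1 smulPair smulPair_apply pairForm_single
  single_eq_mapForm packVH packVH_inl_inr packVH_inr_inl packVH_inl_inl packVH_inr_inr)
open AveragingHessianKernelsRooted (cCountAt)
open PolarizationSign (reflSign axisReflect)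
open ResolventReflection (sref sref_add bref bref_bref bref_of_ne bref_self R1 R1_apply bflip bflip_mem bflip_bflip sum_box_bflip
  sref_block reflSign_self reflSign_of_ne reflSign_mul_self axisReflect_zsmul axisReflect_unitVec_of_ne axisReflect_unitVec_self
  Φ Φ_r_inl Φ_r_inr Φ_s_inl Φ_s_inr)
open RootedComb (segUp_R1_of_ne segUp_R1_self segDown_eq_rev_segUp sref_root_ctr rev_append rev_rev axial_R1)
open RootedKernelReflection (wedge_append bg_rev fl_rev wedge_rev wedge_map_mul wedge_map_smulPair_one eq_of_bg_fl bg_segUp_pairForm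
  fl_segUp_pairForm fref fref_injective fref_fst fref_fref zsgn zsgn_self zsgn_of_ne zsgn_mul_self cast_zsgn R1_single single_fref
  cCountAt_fref cast_cCountAt TKer TKer_apply packVH_bref packVH_sub packVH_neg packVH_reflect_of_TKer packVH_antireflect_of_TKer)
open KernelReflection (refK refK_apply)
open Summit.QuantumFields.BalabanUV.Beta.KernelPermutation (psite psite_apply psite_symm_apply)
open Summit.QuantumFields.BalabanUV.Beta.ResolventPermutation (P1 P1_apply)
open Summit.QuantumFields.BalabanUV.Beta.SymmetrisedAxialPotential (axialPerm symAxial symLinAvgAt card_perm_fin)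
open Summit.QuantumFields.BalabanUV.Beta.SymmetrisedAxialReflection (psite_symm_sref P1_R1 symLinAvgAt_R1)
open Summit.QuantumFields.BalabanUV.Beta.SymAveragingWardRooted (bg_gammaPAt_pairForm fl_gammaPAt_pairForm sum_pair_gammaPAt_sum symZ_eq_symLinU)
open Summit.QuantumFields.BalabanUV.Beta.SymAveragingHessianCounts

variable {d : ℕ}

/-! ## §1 The comb of every axis order is reflection-covariant AS A LETTER LIST -/

/-- [folklore] **`axialP σ (R1 α A) y x = axialP σ A (sref α y) (sref α x)`** — every axis order `σ`, every axis `α`, as LISTS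
(an5's `RootedComb.axial_R1` transported along the pull-back `P1 σ`; the sum-level statement is `SymmetrisedAxialReflection.axialPerm_R1`). -/
theorem axialP_R1 (σ : Equiv.Perm (Fin d)) (α : Fin d) (A : Form1 d ℝ) (y x : Site d) :
    axialP σ (R1 α A) y x = axialP σ A (sref α y) (sref α x) := by
  simp only [axialP, P1g_real, P1_R1, axial_R1, psite_symm_sref]

/-! ## §2 Reflection transport of the centred pair words AS LETTER LISTS (`L` odd) -/

/-- [folklore] **TRANSPORT OF `γ^{σ,σ′}` ACROSS THE AXIS** (`μ ≠ α`): the letters of `R1 α A` along `γ^{σ,σ′,ρ_c}_{(μ,y),x}` ARE the letters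
of `A` along `γ^{σ,σ′,ρ_c}_{(μ, sref y), sref x}` — same orders, same orientation, as LISTS. -/
theorem gammaPAt_R1_of_ne {L : ℕ} (hL : Odd L) (σ σ' : Equiv.Perm (Fin d)) {α μ : Fin d} (h : μ ≠ α) (A : Form1 d ℝ)
    (y : Fin d → ℤ) {b : Fin d → ℕ} (hb : b ∈ box d L) :
    gammaPAt σ σ' (ctr d L) (R1 α A) L μ y b = gammaPAt σ σ' (ctr d L) A L μ (sref α y) (bflip α L b) := by
  have hr := sref_root_ctr (d := d) hL α y
  have hx := sref_block α hb y
  have he : axisReflect α ((L : ℤ) • unitVec μ) = (L : ℤ) • unitVec μ := by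
    rw [axisReflect_zsmul, axisReflect_unitVec_of_ne h]
  have hr' : sref α ((L : ℤ) • y + ctr d L + (L : ℤ) • unitVec μ) = (L : ℤ) • sref α y + ctr d L + (L : ℤ) • unitVec μ := by
    rw [sref_add, hr, he]
  have hx' : sref α ((L : ℤ) • y + toSite b + (L : ℤ) • unitVec μ)
      = (L : ℤ) • sref α y + toSite (bflip α L b) + (L : ℤ) • unitVec μ := by
    rw [sref_add, hx, he]
  simp only [gammaPAt, axialP_R1, segUp_R1_of_ne h, hr, hx, hr', hx']

/-- [folklore] **TRANSPORT OF `γ^{σ,σ′}` ALONG THE AXIS** (`μ = α`): the letters of `R1 α A` along `γ^{σ,σ′,ρ_c}_{(α,y),x}` ARE the letters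
of `A` along `γ^{σ′,σ,ρ_c}_{(α, y′), x′}` REVERSED — THE TWO ORDERS SWAP (the lower comb of the reflected word is the reflected UPPER comb),
`y′ = bref α α y = sref y − e_α`, `x′ = sref x − L e_α` — as LISTS. -/
theorem gammaPAt_R1_self {L : ℕ} (hL : Odd L) (σ σ' : Equiv.Perm (Fin d)) (α : Fin d) (A : Form1 d ℝ) (y : Fin d → ℤ)
    {b : Fin d → ℕ} (hb : b ∈ box d L) :
    gammaPAt σ σ' (ctr d L) (R1 α A) L α y b = rev (gammaPAt σ' σ (ctr d L) A L α (bref α α y) (bflip α L b)) := by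
  have hr := sref_root_ctr (d := d) hL α y
  have hx := sref_block α hb y
  have he : axisReflect α ((L : ℤ) • unitVec α) = -((L : ℤ) • unitVec α) := by
    rw [axisReflect_zsmul, axisReflect_unitVec_self, smul_neg]
  have p1 : sref α ((L : ℤ) • y + ctr d L) = (L : ℤ) • (sref α y - unitVec α) + ctr d L + (L : ℤ) • unitVec α := by
    rw [hr, smul_sub]; abel
  have p2 : sref α ((L : ℤ) • y + toSite b)
      = (L : ℤ) • (sref α y - unitVec α) + toSite (bflip α L b) + (L : ℤ) • unitVec α := by
    rw [hx, smul_sub]; abel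
  have p3 : sref α ((L : ℤ) • y + ctr d L + (L : ℤ) • unitVec α) = (L : ℤ) • (sref α y - unitVec α) + ctr d L := by
    rw [sref_add, hr, he, smul_sub]; abel
  have p4 : sref α ((L : ℤ) • y + toSite b + (L : ℤ) • unitVec α)
      = (L : ℤ) • (sref α y - unitVec α) + toSite (bflip α L b) := by
    rw [sref_add, hx, he, smul_sub]; abel
  have p5 : (L : ℤ) • (sref α y - unitVec α) + toSite (bflip α L b) + (L : ℤ) • unitVec α - (L : ℤ) • unitVec α
      = (L : ℤ) • (sref α y - unitVec α) + toSite (bflip α L b) := add_sub_cancel_right _ _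
  rw [bref_self, gammaPAt, gammaPAt, axialP_R1, axialP_R1, segUp_R1_self, segDown_eq_rev_segUp, p1, p2, p3, p4, p5,
    rev_append, rev_append, rev_rev]
  simp only [List.append_assoc]

/-! ## §3 Pair words: projections, scaling, transport, and the wedge law summed over the order pairs -/

-- (v1.1) the two projections `bg_gammaPAt_pairForm` ∕ `fl_gammaPAt_pairForm` of the pair-form word are S2b's landed
-- `SymAveragingWardRooted.bg_gammaPAt_pairForm` ∕ `fl_gammaPAt_pairForm`, opened BY NAME above (no local copy: `dedup.landed`).

/-- [folklore] The pair word of `(a•A, b•B)` is the rescaled pair word of `(A, B)`. -/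
theorem gammaPAt_pairForm_smul (σ σ' : Equiv.Perm (Fin d)) (ρ : Site d) (a b : ℝ) (A B : Form1 d ℝ) (L : ℕ) (μ : Fin d)
    (y : Site d) (x : Fin d → ℕ) :
    gammaPAt σ σ' ρ (pairForm (a • A) (b • B)) L μ y x = (gammaPAt σ σ' ρ (pairForm A B) L μ y x).map fun p => (a * p.1, b * p.2) := by
  have : pairForm (a • A) (b • B)
      = mapForm ((AddMonoidHom.mulLeft a).prodMap (AddMonoidHom.mulLeft b)) (pairForm A B) := by
    funext κ z; rfl
  rw [this, ← gammaPAt_map]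
  rfl

/-- [folklore] **TRANSPORT OF THE CENTRED PAIR WORD ACROSS THE AXIS** (`μ ≠ α`, `L` odd), as LISTS. -/
theorem gammaPAt_pairForm_R1_of_ne {L : ℕ} (hL : Odd L) (σ σ' : Equiv.Perm (Fin d)) {α μ : Fin d} (h : μ ≠ α)
    (A B : Form1 d ℝ) (y : Fin d → ℤ) {b : Fin d → ℕ} (hb : b ∈ box d L) :
    gammaPAt σ σ' (ctr d L) (pairForm (R1 α A) (R1 α B)) L μ y b
      = gammaPAt σ σ' (ctr d L) (pairForm A B) L μ (sref α y) (bflip α L b) := by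
  apply eq_of_bg_fl
  · rw [bg_gammaPAt_pairForm, bg_gammaPAt_pairForm, gammaPAt_R1_of_ne hL σ σ' h A y hb]
  · rw [fl_gammaPAt_pairForm, fl_gammaPAt_pairForm, gammaPAt_R1_of_ne hL σ σ' h B y hb]

/-- [folklore] **TRANSPORT OF THE CENTRED PAIR WORD ALONG THE AXIS** (`μ = α`, `L` odd): reversed, orders swapped, as LISTS. -/
theorem gammaPAt_pairForm_R1_self {L : ℕ} (hL : Odd L) (σ σ' : Equiv.Perm (Fin d)) (α : Fin d) (A B : Form1 d ℝ)
    (y : Fin d → ℤ) {b : Fin d → ℕ} (hb : b ∈ box d L) :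
    gammaPAt σ σ' (ctr d L) (pairForm (R1 α A) (R1 α B)) L α y b
      = rev (gammaPAt σ' σ (ctr d L) (pairForm A B) L α (bref α α y) (bflip α L b)) := by
  apply eq_of_bg_fl
  · rw [bg_gammaPAt_pairForm, bg_rev, bg_gammaPAt_pairForm, gammaPAt_R1_self hL σ σ' α A y hb]
  · rw [fl_gammaPAt_pairForm, fl_rev, fl_gammaPAt_pairForm, gammaPAt_R1_self hL σ σ' α B y hb]

/-- [folklore] **THE WEDGE LAW, SUMMED OVER THE ORDER PAIRS — ONE LAW FOR ALL AXES** (`L` odd):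
`Σ_{σ,σ′} wedge(γ^{σ,σ′,ρ_c}_{(μ,y),x}; R1 A, R1 B) = ε_μ · Σ_{σ,σ′} wedge(γ^{σ,σ′,ρ_c}_{(μ, bref y), x̃}; A, B)` (along the axis each
summand is `−` the wedge of the SWAPPED pair `(σ′,σ)`; the double sum absorbs the swap). -/
theorem sum_wedge_gammaPAt_pairForm_R1 {L : ℕ} (hL : Odd L) (α μ : Fin d) (A B : Form1 d ℝ) (y : Fin d → ℤ)
    {b : Fin d → ℕ} (hb : b ∈ box d L) :
    ∑ σ : Equiv.Perm (Fin d), ∑ σ' : Equiv.Perm (Fin d), wedge (gammaPAt σ σ' (ctr d L) (pairForm (R1 α A) (R1 α B)) L μ y b)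
      = reflSign α μ * ∑ σ : Equiv.Perm (Fin d), ∑ σ' : Equiv.Perm (Fin d),
          wedge (gammaPAt σ σ' (ctr d L) (pairForm A B) L μ (bref α μ y) (bflip α L b)) := by
  by_cases h : μ = α
  · subst h
    rw [reflSign_self, neg_one_mul, Finset.sum_comm, ← Finset.sum_neg_distrib]
    refine Finset.sum_congr rfl fun σ' _ => ?_
    rw [← Finset.sum_neg_distrib]
    refine Finset.sum_congr rfl fun σ _ => ?_
    rw [gammaPAt_pairForm_R1_self hL σ σ' μ A B y hb, wedge_rev]
  · rw [reflSign_of_ne h, one_mul, bref_of_ne h]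
    refine Finset.sum_congr rfl fun σ _ => Finset.sum_congr rfl fun σ' _ => ?_
    rw [gammaPAt_pairForm_R1_of_ne hL σ σ' h A B y hb]

/-! ## §4 The symmetrised W-Hessian count is the sum of the wedge counts of the OPEN pair words -/

/-- [folklore] **DECOUPLING AT LINEAR ORDER**: summed over BOTH orders, the pair words' letter sums give `d! ·` the symmetrised linear
functional (the lower and upper combs decouple: any pairing of the orders has the same total). -/
theorem sum_sum_gammaPAt_sum {R : Type*} [Ring R] (ρ : Site d) (W : Form1 d R) (L : ℕ) (μ : Fin d) (y : Site d) :
    ∑ b ∈ box d L, ∑ σ : Equiv.Perm (Fin d), ∑ σ' : Equiv.Perm (Fin d), (gammaPAt σ σ' ρ W L μ y b).sum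
      = (d ! : ℤ) • symLinU ρ W L μ y := by
  rw [sum_pair_gammaPAt_sum, symZ_eq_symLinU]

/-- [folklore] **THE SYMMETRISED W-HESSIAN COUNT IS THE SUM OF THE WEDGE COUNTS OF THE OPEN PAIR WORDS** `γ^{σ,σ′,ρ}_{c,x}`,
`x ∈ B(y)`, `σ, σ′ ∈ S_d`, for EVERY root `ρ`: the closing segment `−c` of the loops and the two compensating terms of the definition
cancel identically (the pair-word twin of an5's `hessCountAt_eq_sum_wedge`). -/
theorem symHessCountAt_eq_sum_wedge (ρ : Site d) (L : ℕ) (μ : Fin d) (y : Site d) (f f' : Bond d) :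
    symHessCountAt ρ L μ y f f'
      = ∑ b ∈ box d L, ∑ σ : Equiv.Perm (Fin d), ∑ σ' : Equiv.Perm (Fin d), wedge (gammaPAt σ σ' ρ (pairForm (δ1 f) (δ1 f')) L μ y b) := by
  set s := segUp (pairForm (δ1 f) (δ1 f')) ((L : ℤ) • y + ρ) μ L with hs
  have hbs : (bg s).sum = cCountAt ρ L μ y f := by rw [hs, bg_segUp_pairForm]; rfl
  have hfs : (fl s).sum = cCountAt ρ L μ y f' := by rw [hs, fl_segUp_pairForm]; rfl
  have hloop : ∀ (σ σ' : Equiv.Perm (Fin d)) b, wedge (loopPAt σ σ' ρ (pairForm (δ1 f) (δ1 f')) L μ y b)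
      = wedge (gammaPAt σ σ' ρ (pairForm (δ1 f) (δ1 f')) L μ y b) - wedge s
        - (gammaPAt σ σ' ρ (δ1 f) L μ y b).sum * cCountAt ρ L μ y f'
        + (gammaPAt σ σ' ρ (δ1 f') L μ y b).sum * cCountAt ρ L μ y f := by
    intro σ σ' b
    rw [show loopPAt σ σ' ρ (pairForm (δ1 f) (δ1 f')) L μ y b = gammaPAt σ σ' ρ (pairForm (δ1 f) (δ1 f')) L μ y b ++ rev s
        from rfl, wedge_append, wedge_rev, bg_rev, fl_rev, rev_sum, rev_sum, hbs, hfs, bg_gammaPAt_pairForm,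
      fl_gammaPAt_pairForm]
    ring
  have hlin : ∀ g : Bond d, ∑ b ∈ box d L, ∑ σ : Equiv.Perm (Fin d), ∑ σ' : Equiv.Perm (Fin d),
      (gammaPAt σ σ' ρ (δ1 g) L μ y b).sum = (d ! : ℤ) * symLinCountAt ρ L μ y g := fun g => by
    rw [sum_sum_gammaPAt_sum, smul_eq_mul]; rfl
  have hcard : (box d L).card = L ^ d := by simp [AffineAveraging.box, Fintype.card_piFinset]
  rw [symHessCountAt, symWedgeCountAt,
    Finset.sum_congr rfl fun b _ => Finset.sum_congr rfl fun σ _ => Finset.sum_congr rfl fun σ' _ => hloop σ σ' b]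
  simp only [Finset.sum_add_distrib, Finset.sum_sub_distrib, Finset.sum_const, Finset.card_univ, card_perm_fin, hcard,
    ← Finset.sum_mul, hlin]
  rw [← hs]
  ring

/-- [folklore] The symmetrised integer count `LIN⁰⁴∕d!` read in `ℝ` through the unit single-bond form. -/
theorem cast_symLinCountAt (ρ : Site d) (L : ℕ) (μ : Fin d) (y : Site d) (f : Bond d) :
    ((symLinCountAt ρ L μ y f : ℤ) : ℝ) = symLinAvgAt ρ (single f (1 : ℝ)) L μ y := by
  rw [← symLinU_real, symLinU_single, Int.smul_one_eq_cast]

/-- [folklore] The symmetrised W-Hessian count read in `ℝ`: the double order sum of the wedge counts of the real unit pair words. -/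
theorem cast_symHessCountAt (ρ : Site d) (L : ℕ) (μ : Fin d) (y : Site d) (f f' : Bond d) :
    ((symHessCountAt ρ L μ y f f' : ℤ) : ℝ)
      = ∑ b ∈ box d L, ∑ σ : Equiv.Perm (Fin d), ∑ σ' : Equiv.Perm (Fin d),
          wedge (gammaPAt σ σ' ρ (pairForm (single f (1 : ℝ)) (single f' (1 : ℝ))) L μ y b) := by
  rw [symHessCountAt_eq_sum_wedge, Int.cast_sum]
  refine Finset.sum_congr rfl fun b _ => ?_
  rw [Int.cast_sum]
  refine Finset.sum_congr rfl fun σ _ => ?_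
  rw [Int.cast_sum]
  refine Finset.sum_congr rfl fun σ' _ => ?_
  rw [pairForm_single, ← gammaPAt_map, wedge_map_smulPair_one]


/-! ## §5 The pure sign laws of the symmetrised counts `LIN⁰⁴∕d!` and `HESS⁰⁴`, and the product-chart count `VH⁰⁴` up to two contacts -/

/-- [folklore] **THE SYMMETRISED LINEAR COUNT IS REFLECTION-COVARIANT** (centred root, `L` odd, every axis):
`q_sym(f̄)_{(μ, y)} = ε_{f.1} ε_μ · q_sym(f)_{(μ, y′)}`, `y′ = bref α μ y` (S1e's `symLinAvgAt_R1` read on the unit single-bond form). -/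
theorem symLinCountAt_fref {L : ℕ} (hL : Odd L) (α μ : Fin d) (y : Fin d → ℤ) (f : Bond d) :
    symLinCountAt (ctr d L) L μ y (fref α f) = zsgn α f.1 * zsgn α μ * symLinCountAt (ctr d L) L μ (bref α μ y) f := by
  have key : symLinAvgAt (ctr d L) (R1 α (single f (1 : ℝ))) L μ y
      = reflSign α μ * symLinAvgAt (ctr d L) (single f (1 : ℝ)) L μ (bref α μ y) := by
    rw [symLinAvgAt_R1 hL, R1_apply]
  rw [R1_single, mul_one, ← symLinU_real, ← symLinU_real, symLinU_single, symLinU_single, zsmul_eq_mul, zsmul_eq_mul,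
    mul_one] at key
  have h2 : ((symLinCountAt (ctr d L) L μ y (fref α f) : ℤ) : ℝ)
      = reflSign α f.1 * reflSign α μ * symLinCountAt (ctr d L) L μ (bref α μ y) f := by
    linear_combination (reflSign α f.1) * key
      - (symLinCountAt (ctr d L) L μ y (fref α f) : ℝ) * reflSign_mul_self α f.1
  have h3 : ((symLinCountAt (ctr d L) L μ y (fref α f) : ℤ) : ℝ)
      = ((zsgn α f.1 * zsgn α μ * symLinCountAt (ctr d L) L μ (bref α μ y) f : ℤ) : ℝ) := by
    rw [Int.cast_mul, Int.cast_mul, cast_zsgn, cast_zsgn]; exact h2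
  exact_mod_cast h3

/-- [folklore] **THE SYMMETRISED W-HESSIAN COUNT IS REFLECTION-COVARIANT** (centred root, `L` odd, every axis):
`h_sym(f̄, f̄′)_{(μ,y)} = ε_{f.1} ε_{f′.1} ε_μ · h_sym(f, f′)_{(μ,y′)}`. -/
theorem symHessCountAt_fref {L : ℕ} (hL : Odd L) (α μ : Fin d) (y : Fin d → ℤ) (f f' : Bond d) :
    symHessCountAt (ctr d L) L μ y (fref α f) (fref α f')
      = zsgn α f.1 * zsgn α f'.1 * zsgn α μ * symHessCountAt (ctr d L) L μ (bref α μ y) f f' := by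
  have h2 : ((symHessCountAt (ctr d L) L μ y (fref α f) (fref α f') : ℤ) : ℝ)
      = reflSign α f.1 * reflSign α f'.1 * reflSign α μ * symHessCountAt (ctr d L) L μ (bref α μ y) f f' := by
    rw [cast_symHessCountAt, cast_symHessCountAt, single_fref, single_fref, Finset.mul_sum,
      ← sum_box_bflip α L (fun b => reflSign α f.1 * reflSign α f'.1 * reflSign α μ *
          ∑ σ : Equiv.Perm (Fin d), ∑ σ' : Equiv.Perm (Fin d),
            wedge (gammaPAt σ σ' (ctr d L) (pairForm (single f (1 : ℝ)) (single f' (1 : ℝ))) L μ (bref α μ y) b))]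
    refine Finset.sum_congr rfl fun b hb => ?_
    simp only [gammaPAt_pairForm_smul, wedge_map_mul, ← Finset.mul_sum]
    rw [sum_wedge_gammaPAt_pairForm_R1 hL α μ _ _ y hb]
    ring
  have h3 : ((symHessCountAt (ctr d L) L μ y (fref α f) (fref α f') : ℤ) : ℝ)
      = ((zsgn α f.1 * zsgn α f'.1 * zsgn α μ * symHessCountAt (ctr d L) L μ (bref α μ y) f f' : ℤ) : ℝ) := by
    rw [Int.cast_mul, Int.cast_mul, Int.cast_mul, cast_zsgn, cast_zsgn, cast_zsgn]; exact h2
  exact_mod_cast h3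

/-- [folklore] **REFLECTION LAW OF THE SYMMETRISED PRODUCT-CHART FIELD–MULTIPLIER COUNT** (centred root, `L` odd, every axis `α`):
`m_sym(f̄, f̄′)_{(μ,y)} = ε_{f.1} ε_{f′.1} · ( ε_μ m_sym(f,f′)_{(μ,y′)} − 2ε_μ L^d d! [f = f′ ∧ f ∥ α] q_sym(f)_{(μ,y′)} − (1 − ε_μ) q_sym(f) q_sym(f′) )`
— the pure part is the law of `h_sym` and `q_sym`, the two CONTACT TERMS are the same-bond BCH contact on `α`-bonds and, on the reflected
coarse axis only, the rank-one `q ⊗ q` summand (pair-word twin of an5's `vhCountAt_fref`; the weight `d!` of `LIN⁰⁴∕d!` rides along). -/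
theorem symVhCountAt_fref {L : ℕ} (hL : Odd L) (α μ : Fin d) (y : Fin d → ℤ) (f f' : Bond d) :
    symVhCountAt (ctr d L) L μ y (fref α f) (fref α f')
      = zsgn α f.1 * zsgn α f'.1 *
          (zsgn α μ * symVhCountAt (ctr d L) L μ (bref α μ y) f f'
            - 2 * (L : ℤ) ^ d * (d ! : ℤ) * zsgn α μ *
                (if f = f' ∧ f.1 = α then symLinCountAt (ctr d L) L μ (bref α μ y) f else 0)
            - (1 - zsgn α μ) * (symLinCountAt (ctr d L) L μ (bref α μ y) f * symLinCountAt (ctr d L) L μ (bref α μ y) f')) := by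
  rw [symVhCountAt, symVhCountAt, symHessCountAt_fref hL, symLinCountAt_fref hL, symLinCountAt_fref hL]
  have hμ := zsgn_mul_self α μ
  obtain rfl | hne := eq_or_ne f f'
  · rw [if_pos rfl, if_pos rfl]
    by_cases h1 : f.1 = α
    · have e1 : zsgn α f.1 = -1 := by rw [h1]; exact zsgn_self α
      rw [if_pos ⟨rfl, h1⟩, e1]
      linear_combination (-(symLinCountAt (ctr d L) L μ (bref α μ y) f * symLinCountAt (ctr d L) L μ (bref α μ y) f)) * hμ
    · rw [if_neg (fun h => h1 h.2), zsgn_of_ne h1]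
      linear_combination (-(symLinCountAt (ctr d L) L μ (bref α μ y) f * symLinCountAt (ctr d L) L μ (bref α μ y) f)) * hμ
  · have hne' : fref α f ≠ fref α f' := fun h => hne (fref_injective α h)
    rw [if_neg hne', if_neg hne, if_neg (fun h => hne h.1)]
    linear_combination
      (-(zsgn α f.1 * zsgn α f'.1 * symLinCountAt (ctr d L) L μ (bref α μ y) f * symLinCountAt (ctr d L) L μ (bref α μ y) f'))
        * hμ

end Summit.QuantumFields.BalabanUV.Beta.SymRootedKernelReflection
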